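import Mathlib.Analysis.Calculus.Deriv.Basic
import Mathlib.Analysis.Calculus.ContDiff.Basic
import Mathlib.Analysis.SpecialFunctions.Sqrt
import Mathlib.Analysis.Complex.Basic
import Literature.Geometry.Lorentzian.WeylPapapetrouData
import HarnessLib

/-!
# The `n`-black-hole axis boundary value problem for the vacuum Ernst equation

Topic `Literature/Geometry/Lorentzian`. Definition request `defn-Ernst.nBlackHoleAxisBVP` (companion
of fact item `wi-37346`, route `FinalStateConjecture`, solvent-sweep cell "SOS × multi-black-hole
balance"): the HYPOTHESIS CLASS of J. Hennig's axis-potential theorem — stationary axisymmetric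
vacuum exteriors of `n` aligned rotating black holes in Weyl(–Lewis–Papapetrou) coordinates, as a
boundary value problem for the Ernst equation — together with the upper-axis Ernst potential
`upperAxisPotential`, over the vocabulary of `WeylPapapetrouData.lean` (`weylHalfPlane`).

## What the sources print

* Neugebauer–Hennig, *Stationary two-black-hole configurations: A non-existence proof*,
  J. Geom. Phys. 62 (2012) 613–630 = arXiv:1105.5830 (`NeugebauerHennig2012`), §2 "A boundary
  problem for disconnected horizons": line element
  `ds² = e^{−2U}[e^{2k}(dρ² + dζ²) + ρ² dφ²] − e^{2U}(dt + a dφ)²` with `U, a, k` functions of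
  `(ρ, ζ)`; `e^{2U} = −ξⁱξᵢ`, `a = −e^{−2U} ηⁱξᵢ` for the Killing vectors `ξ = ∂_t`, `η = ∂_φ`;
  horizons `ℋ(ξ + Ω η)` "are located on the ζ-axis (ρ = 0) and cover a finite portion of the axis";
  "The gravitational fields `a, k, U` have to satisfy the following boundary conditions
  (B1) `𝒜^±, 𝒜⁰: a = 0, k = 0`; (B2) `ℋ⁽ⁱ⁾: 1 + Ω_i a = 0`; (B3) `𝒞: U → 0, a → 0, k → 0`, where
  `Ω₁` and `Ω₂` are the angular velocities of the two horizons"; the Ernst potential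
  `f = e^{2U} + i b` with the twist potential `b` defined by `a_{,ρ} = ρ e^{−4U} b_{,ζ}`,
  `a_{,ζ} = −ρ e^{−4U} b_{,ρ}`; the Ernst equation
  `(Re f)(f_{,ρρ} + f_{,ζζ} + ρ^{−1} f_{,ρ}) = f_{,ρ}² + f_{,ζ}²`; and the reduced problem for the Ernst
  equation `𝒜: a = 0`, `ℋ⁽ⁱ⁾: 1 + Ω_i a = 0`, `𝒞: U → 0, a → 0` ("Equations (Ernst) and (k1) are
  completely equivalent to the Einstein vacuum equations … we will first analyze the boundary
  problem … for the Ernst equation"); §4: at the points where axis parts and horizons meet "`f` must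
  be continuous and unique there"; §5: "our analysis of the two-horizon problem can easily be
  extended to an arbitrary number `n` … `n` horizons `ℋ` and `n + 1` 'regular' intervals `𝒜`".
* Hennig, *Axis potentials for stationary `n`-black-hole configurations*, Class. Quantum Grav. 37
  (2020) 19LT01 = arXiv:2009.03992 (`Hennig2020`), §2: "`n` aligned black holes … rotate with angular
  velocities `Ω_i ≠ 0`, `i = 1, …, n`. In Weyl–Lewis–Papapetrou coordinates `(ρ, ζ, φ, t)`, the event
  horizons `ℋ₁, …, ℋ_n` correspond to intervals on the `ζ`-axis, and we denote the endpoints of these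
  intervals by `K₁, K₂; K₃, K₄; …; K_{2n−1}, K_{2n}`", the remaining parts `𝒜₁, …, 𝒜_{n+1}` of the
  axis being the symmetry axis; §3: the solutions of the linear problem on `𝒜_j` and `ℋ_j` are
  "restricted by the requirement of continuity … at `ζ = K_j`", and at infinity "the required
  fall-off behaviour of the Ernst potentials in an asymptotically flat spacetime" is used; the final
  result (§3, eq. (Ernstformulae)) is the rational form `ℰ(ζ) = π_n(ζ)/r_n(ζ)` of the upper-axis
  values — the statement of fact item `wi-37346`, NOT vendored here.
* Stephani–Kramer–MacCallum–Hoenselaers–Herlt, *Exact Solutions of Einstein's Field Equations*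
  (2nd ed. 2003) (`StephaniEtAl2003`): metric (19.21) (same form, `A` for `a`), Ernst equation in
  Weyl's canonical coordinates (19.41) `(Γ + Γ̄)(Γ_{,ρρ} + ρ^{−1}Γ_{,ρ} + Γ_{,zz}) = 2(Γ_{,ρ}² + Γ_{,z}²)`,
  `A_{,ζ} = 2ρ (Γ − Γ̄)_{,ζ}/(Γ + Γ̄)²` (19.42), `ξ ≡ (1 − ℰ)/(1 + ℰ)` (19.46), prolate spheroidal
  coordinates `ρ = σ(x² − 1)^{1/2}(1 − y²)^{1/2}`, `z = σxy` (20.6), and the Kerr solution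
  `ξ^{−1} = px − iqy`, `p² + q² = 1`, `mq = a`, `mp = σ` (20.35)–(20.36).

## The Lean rendering (modelling choices, flagged)

`Ernst.NBlackHoleAxisBVP n` (abbrev `Ernst.nBlackHoleAxisBVP n`) packages, for `n : ℕ`:
1. DATA regular across ergosurfaces: `V = e^{2U} = −g(ξ,ξ)`, `W = g(ξ,η)` and the twist potential
   `b`, as functions `ℝ × ℝ → ℝ` of `(ρ, ζ)`; the Ernst potential is `f = V + i b`
   (`ernstPotential`) and NH's `a` is the DERIVED quotient `a = −W/V` (`gravitomagnetic`; it is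
   singular where `V = 0`, i.e. on ergosurfaces and at the rod endpoints, which is why `W`, not `a`,
   is the datum). The twist relations are recorded multiplied through by `V²`:
   `ρ b_{,ζ} = W V_{,ρ} − V W_{,ρ}`, `ρ b_{,ρ} = V W_{,ζ} − W V_{,ζ}` (equivalent to NH's where `V ≠ 0`).
2. ROD STRUCTURE: `K : Fin (2n) → ℝ` strictly decreasing (`K 0 > K 1 > ⋯`, Hennig's
   `K₁ > ⋯ > K_{2n}` shifted to `0`-based indices), horizon rods `horizonRod K i = (K(2i+1), K(2i))`,
   axis `axisSet K` = complement of the closed rods, and angular velocities `Ω : Fin n → ℝ`.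
3. REGULARITY (the papers fix no function spaces; this is the minimal reading of "regular axis /
   horizons", "`f` continuous at the `K_j`", flagged): `V, W, b` are `C^∞` on the closed half-plane
   with the rod endpoints removed (interior AND boundary segments: `ContDiffOn` on a non-open set,
   i.e. smooth up to the boundary away from the `K_j`) and continuous on the whole closed
   half-plane.
4. FIELD EQUATIONS on `{ρ > 0}`: the vacuum Ernst equation for `f` (`SolvesErnstVacuum`, partial
   derivatives `pdρ`, `pdζ` taken along coordinate slices) and the two twist relations.
5. BOUNDARY CONDITIONS, literally NH (B1)–(B2) without `k`: `W(0, ζ) = 0` on the axis (this is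
   `a = 0`, in the form "`η → 0`" from which NH derive it), `1 + Ω_i a(0, ζ) = 0` on the `i`-th rod
   (with Lean's `x/0 = 0` this forces `V(0,ζ) ≠ 0` and `Ω_i ≠ 0` there, as in the sources:
   `Ω_ne_zero`, `V_ne_zero_of_mem_horizonRod`). The strut condition `k = 0` on the axis is NOT part
   of the class (conclusion-side, item `defn-Ernst.balanceCandidates`).
6. ASYMPTOTICS, NH (B3) with the Ernst normalisation: `V → 1`, `W → 0`, `b → 0` along the cocompact
   filter of the closed half-plane.
NOT ENCODED (scope flags for any fact vendored over this class): the metric function `k` and its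
line integral; positivity/signature side conditions; decay RATES at infinity and analyticity up to
the axis, which the linear-problem arguments of [Hennig2020, §3] use implicitly; the electrovacuum
(`Φ ≠ 0`) case. `upperAxisPotential S ζ = f(0, ζ)` (meaningful for `ζ ∈ upperAxis S.K`).

Sanity content: `minkowski : NBlackHoleAxisBVP 0` (flat space, `f ≡ 1`) inhabits the class at
`n = 0`; for `n = 1` the Kerr Ernst potential in Weyl coordinates (`kerrErnstPotential`, transcribed
from [StephaniEtAl2003, (19.46), (20.6), (20.35)]) has the upper-axis values
`(ζ − M − ia)/(ζ + M − ia)` (`kerrErnstPotential_upperAxis`) — the `n = 1` axis data of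
[Hennig2020, §3]; that `kerrErnstPotential` with the Kerr `W` is an `NBlackHoleAxisBVP 1` (solves
(19.41), boundary behaviour) is NOT proved here (TODO: separate theorem).

## References

* G. Neugebauer, J. Hennig, J. Geom. Phys. 62 (2012) 613–630, arXiv:1105.5830, §2 (eqs. (LE),
  (B1)–(B3), (f), (a), (Ernst)), §4, §5 [NeugebauerHennig2012].
* J. Hennig, Class. Quantum Grav. 37 (2020) 19LT01, arXiv:2009.03992, §2, §3 [Hennig2020].
* H. Stephani, D. Kramer, M. MacCallum, C. Hoenselaers, E. Herlt, *Exact Solutions of Einstein's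
  Field Equations*, 2nd ed., CUP 2003, (19.21), (19.41), (19.42), (19.46), (20.6), (20.35)–(20.36)
  [StephaniEtAl2003].
* P. T. Chruściel, J. L. Costa, Astérisque 321 (2008), §6.3–6.4 (Weyl coordinates; tree file
  `WeylPapapetrouData.lean`) [ChruscielCosta2008].
-/

noncomputable section

open scoped ContDiff Topology
open Filter Set

namespace Literature.Geometry.Lorentzian

namespace Ernst

/-! ### The closed half-plane and slice partial derivatives -/

/-- The closed Weyl half-plane `{(ρ, ζ) : ρ ≥ 0}` (orbit space including the axis `ρ = 0`).
[cite: NeugebauerHennig2012, §2] -/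
def weylClosedHalfPlane : Set (ℝ × ℝ) := {p | 0 ≤ p.1}

/-- The open half-plane lies in the closed one. [folklore] -/
theorem weylHalfPlane_subset_closed : weylHalfPlane ⊆ weylClosedHalfPlane :=
  fun p (hp : 0 < p.1) => show 0 ≤ p.1 from hp.le

section Derivatives

variable {E : Type*} [NormedAddCommGroup E] [NormedSpace ℝ E]

/-- `∂_ρ F` at `p = (ρ, ζ)`: the derivative of the slice `s ↦ F (s, ζ)` at `ρ`. [folklore] -/
def pdρ (F : ℝ × ℝ → E) (p : ℝ × ℝ) : E :=
  deriv (fun s => F (s, p.2)) p.1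

/-- `∂_ζ F` at `p = (ρ, ζ)`: the derivative of the slice `s ↦ F (ρ, s)` at `ζ`. [folklore] -/
def pdζ (F : ℝ × ℝ → E) (p : ℝ × ℝ) : E :=
  deriv (fun s => F (p.1, s)) p.2

/-- Slice derivatives of a constant vanish. [folklore] -/
@[simp]
theorem pdρ_const (c : E) (p : ℝ × ℝ) : pdρ (fun _ => c) p = 0 := by
  simp [pdρ]

/-- Slice derivatives of a constant vanish. [folklore] -/
@[simp]
theorem pdζ_const (c : E) (p : ℝ × ℝ) : pdζ (fun _ => c) p = 0 := by
  simp [pdζ]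

end Derivatives

/-! ### The vacuum Ernst equation in Weyl coordinates -/

/-- The residual of the **vacuum Ernst equation** in Weyl's canonical coordinates,
`(Re f)(f_{,ρρ} + ρ^{−1} f_{,ρ} + f_{,ζζ}) − (f_{,ρ}² + f_{,ζ}²)` (NH's form; Stephani et al.'s
(19.41) is twice this with `Γ + Γ̄ = 2 Re Γ`). [cite: NeugebauerHennig2012, §2 (eq. (Ernst))]
[cite: StephaniEtAl2003, (19.41)] -/
def ernstResidual (f : ℝ × ℝ → ℂ) (p : ℝ × ℝ) : ℂ :=
  ((f p).re : ℂ) * (pdρ (pdρ f) p + pdρ f p / (p.1 : ℂ) + pdζ (pdζ f) p) -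
    (pdρ f p ^ 2 + pdζ f p ^ 2)

/-- `f` **solves the vacuum Ernst equation** on the open half-plane `{ρ > 0}`.
[cite: NeugebauerHennig2012, §2 (eq. (Ernst))] -/
def SolvesErnstVacuum (f : ℝ × ℝ → ℂ) : Prop :=
  ∀ p ∈ weylHalfPlane, ernstResidual f p = 0

/-- The Ernst potential `f = e^{2U} + i b = V + i b` assembled from its real part `V = −g(ξ, ξ)` and
the twist potential `b`. [cite: NeugebauerHennig2012, §2 (eq. (f))] -/
def ernstPotentialOf (V b : ℝ × ℝ → ℝ) (p : ℝ × ℝ) : ℂ :=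
  (V p : ℂ) + (b p : ℂ) * Complex.I

/-- `Re f = V`. [folklore] -/
@[simp]
theorem ernstPotentialOf_re (V b : ℝ × ℝ → ℝ) (p : ℝ × ℝ) : (ernstPotentialOf V b p).re = V p := by
  simp [ernstPotentialOf]

/-- `Im f = b`. [folklore] -/
@[simp]
theorem ernstPotentialOf_im (V b : ℝ × ℝ → ℝ) (p : ℝ × ℝ) : (ernstPotentialOf V b p).im = b p := by
  simp [ernstPotentialOf]

/-- NH's gravitomagnetic potential `a = −e^{−2U} ηⁱξᵢ = −W/V` as a DERIVED function of
`V = e^{2U}` and `W = g(ξ, η)` (`g_{tφ} = −a e^{2U}` in the line element (LE)); Lean's convention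
`x / 0 = 0` makes it total (junk where `V = 0`). [cite: NeugebauerHennig2012, §2 (eq. (coordfree))] -/
def gravitomagneticOf (V W : ℝ × ℝ → ℝ) (p : ℝ × ℝ) : ℝ :=
  -(W p / V p)

/-! ### Rod structure on the axis `ρ = 0` -/

section Rods

variable {n : ℕ}

/-- The `i`-th **horizon rod** (`0`-based): the open interval `(K(2i+1), K(2i))` of the `ζ`-axis
(Hennig's `ℋ_{i+1}` with endpoints `K_{2i+1} > K_{2i+2}` in `1`-based numbering).
[cite: Hennig2020, §2] -/
def horizonRod (K : Fin (2 * n) → ℝ) (i : Fin n) : Set ℝ :=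
  Ioo (K ⟨2 * (i : ℕ) + 1, by have := i.isLt; omega⟩) (K ⟨2 * (i : ℕ), by have := i.isLt; omega⟩)

/-- The closed `i`-th horizon rod (with its two endpoints). [cite: Hennig2020, §2] -/
def closedHorizonRod (K : Fin (2 * n) → ℝ) (i : Fin n) : Set ℝ :=
  Icc (K ⟨2 * (i : ℕ) + 1, by have := i.isLt; omega⟩) (K ⟨2 * (i : ℕ), by have := i.isLt; omega⟩)

/-- The **symmetry axis** part of `{ρ = 0}`: the `ζ` not on any closed horizon rod — the union of
Hennig's `n + 1` open axis segments `𝒜₁, …, 𝒜_{n+1}` (rod endpoints excluded).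
[cite: Hennig2020, §2] -/
def axisSet (K : Fin (2 * n) → ℝ) : Set ℝ :=
  {ζ | ∀ i : Fin n, ζ ∉ closedHorizonRod K i}

/-- The **upper axis** `𝒜₁ = {ζ > K₁}` (all of the axis when `n = 0`). [cite: Hennig2020, §2] -/
def upperAxis (K : Fin (2 * n) → ℝ) : Set ℝ :=
  {ζ | ∀ j : Fin (2 * n), K j < ζ}

/-- The rod endpoints `(0, K_j)` as points of the closed half-plane. [cite: Hennig2020, §2] -/
def rodEndpoints (K : Fin (2 * n) → ℝ) : Set (ℝ × ℝ) :=
  {p | p.1 = 0 ∧ ∃ j : Fin (2 * n), p.2 = K j}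

/-- The upper axis is part of the symmetry axis. [folklore] -/
theorem upperAxis_subset_axisSet (K : Fin (2 * n) → ℝ) : upperAxis K ⊆ axisSet K := by
  intro ζ hζ i hi
  exact (not_le.mpr (hζ ⟨2 * (i : ℕ), by have := i.isLt; omega⟩)) hi.2

/-- A horizon rod of a strictly decreasing rod structure is non-empty. [folklore] -/
theorem horizonRod_nonempty {K : Fin (2 * n) → ℝ} (hK : StrictAnti K) (i : Fin n) :
    (horizonRod K i).Nonempty :=
  nonempty_Ioo.mpr (hK (Fin.mk_lt_mk.mpr (Nat.lt_succ_self _)))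

/-- Horizon rods miss the symmetry axis. [folklore] -/
theorem not_mem_axisSet_of_mem_horizonRod {K : Fin (2 * n) → ℝ} {i : Fin n} {ζ : ℝ}
    (h : ζ ∈ horizonRod K i) : ζ ∉ axisSet K :=
  fun hax => hax i (Ioo_subset_Icc_self h)

end Rods

/-! ### The hypothesis class -/

/-- **The `n`-black-hole axis boundary value problem for the vacuum Ernst equation** (hypothesis
class of Hennig's axis-potential theorem; see the module docstring for the flagged modelling
choices). Data: `V = e^{2U} = −g(ξ,ξ)`, `W = g(ξ,η)`, twist potential `b` on the `(ρ, ζ)`-plane, a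
strictly decreasing rod structure `K : Fin (2n) → ℝ` and angular velocities `Ω : Fin n → ℝ`.
Axioms: smoothness on the closed half-plane minus the rod endpoints and continuity on the closed
half-plane; the vacuum Ernst equation for `f = V + i b` and the twist relations
`ρ b_{,ζ} = W V_{,ρ} − V W_{,ρ}`, `ρ b_{,ρ} = V W_{,ζ} − W V_{,ζ}` (`a_{,ρ} = ρ e^{−4U} b_{,ζ}`,
`a_{,ζ} = −ρ e^{−4U} b_{,ρ}` with `a = −W/V`) on `{ρ > 0}`; the boundary conditions
(B1) `a = 0` on the axis (as `W(0,ζ) = 0`), (B2) `1 + Ω_i a = 0` on the `i`-th horizon rod;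
(B3) `U → 0`, `a → 0` at infinity with the Ernst normalisation `b → 0`
(as `V → 1`, `W → 0`, `b → 0`). [cite: NeugebauerHennig2012, §2 (eqs. (B1)–(B3), (f), (a), (Ernst))]
[cite: Hennig2020, §2] -/
structure NBlackHoleAxisBVP (n : ℕ) where
  /-- `V = e^{2U} = −g(ξ, ξ)`, the real part of the Ernst potential. -/
  V : ℝ × ℝ → ℝ
  /-- `W = g(ξ, η) = g_{tφ} = −a e^{2U}`. -/
  W : ℝ × ℝ → ℝ
  /-- The twist potential `b = Im f`. -/
  b : ℝ × ℝ → ℝ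
  /-- The rod endpoints `K 0 > K 1 > ⋯ > K (2n−1)` on the `ζ`-axis. -/
  K : Fin (2 * n) → ℝ
  /-- The endpoints are strictly decreasing. -/
  K_strictAnti : StrictAnti K
  /-- The angular velocities `Ω_i` of the horizons. -/
  Ω : Fin n → ℝ
  /-- `V` is smooth up to the boundary away from the rod endpoints. -/
  V_smooth : ContDiffOn ℝ ∞ V (weylClosedHalfPlane \ rodEndpoints K)
  /-- `W` is smooth up to the boundary away from the rod endpoints. -/
  W_smooth : ContDiffOn ℝ ∞ W (weylClosedHalfPlane \ rodEndpoints K)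
  /-- `b` is smooth up to the boundary away from the rod endpoints. -/
  b_smooth : ContDiffOn ℝ ∞ b (weylClosedHalfPlane \ rodEndpoints K)
  /-- `V` is continuous on the closed half-plane (also at the rod endpoints). -/
  V_continuousOn : ContinuousOn V weylClosedHalfPlane
  /-- `W` is continuous on the closed half-plane (also at the rod endpoints). -/
  W_continuousOn : ContinuousOn W weylClosedHalfPlane
  /-- `b` is continuous on the closed half-plane ("`f` must be continuous and unique there"). -/
  b_continuousOn : ContinuousOn b weylClosedHalfPlane
  /-- The vacuum Ernst equation for `f = V + i b` on `{ρ > 0}`. -/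
  ernst : SolvesErnstVacuum (ernstPotentialOf V b)
  /-- Twist relation `ρ b_{,ζ} = W V_{,ρ} − V W_{,ρ}` (`a_{,ρ} = ρ e^{−4U} b_{,ζ}`) on `{ρ > 0}`. -/
  twist_ρ : ∀ p ∈ weylHalfPlane, p.1 * pdζ b p = W p * pdρ V p - V p * pdρ W p
  /-- Twist relation `ρ b_{,ρ} = V W_{,ζ} − W V_{,ζ}` (`a_{,ζ} = −ρ e^{−4U} b_{,ρ}`) on `{ρ > 0}`. -/
  twist_ζ : ∀ p ∈ weylHalfPlane, p.1 * pdρ b p = V p * pdζ W p - W p * pdζ V p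
  /-- (B1) on the symmetry axis `a = 0`, i.e. `g(ξ, η) = 0` (`η → 0`). -/
  axis_W : ∀ ζ ∈ axisSet K, W (0, ζ) = 0
  /-- (B2) on the `i`-th horizon rod `1 + Ω_i a = 0`, `a = −W/V`. -/
  horizon : ∀ (i : Fin n), ∀ ζ ∈ horizonRod K i, 1 + Ω i * gravitomagneticOf V W (0, ζ) = 0
  /-- (B3) `U → 0` at infinity: `V = e^{2U} → 1`. -/
  V_tendsto : Tendsto V (cocompact (ℝ × ℝ) ⊓ 𝓟 weylClosedHalfPlane) (𝓝 1)
  /-- (B3) `a → 0` at infinity: `W = −a e^{2U} → 0`. -/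
  W_tendsto : Tendsto W (cocompact (ℝ × ℝ) ⊓ 𝓟 weylClosedHalfPlane) (𝓝 0)
  /-- Ernst normalisation `f → 1`: `b → 0` at infinity. -/
  b_tendsto : Tendsto b (cocompact (ℝ × ℝ) ⊓ 𝓟 weylClosedHalfPlane) (𝓝 0)

/-- The requested name `Ernst.nBlackHoleAxisBVP` (item `defn-Ernst.nBlackHoleAxisBVP`).
[cite: Hennig2020, §2] -/
abbrev nBlackHoleAxisBVP (n : ℕ) : Type := NBlackHoleAxisBVP n

namespace NBlackHoleAxisBVP

variable {n : ℕ} (S : NBlackHoleAxisBVP n)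

/-- The Ernst potential `f = V + i b` of the configuration. [cite: NeugebauerHennig2012, §2 (eq. (f))] -/
def ernstPotential : ℝ × ℝ → ℂ :=
  ernstPotentialOf S.V S.b

/-- NH's `a = −W/V`. [cite: NeugebauerHennig2012, §2 (eq. (coordfree))] -/
def gravitomagnetic : ℝ × ℝ → ℝ :=
  gravitomagneticOf S.V S.W

/-- **The upper-axis Ernst potential** `ζ ↦ f(0, ζ)` (Hennig's `ℰ` on `𝒜₁`; meaningful for
`ζ ∈ upperAxis S.K`, total by the same formula elsewhere). [cite: Hennig2020, §3] -/
def upperAxisPotential (ζ : ℝ) : ℂ :=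
  S.ernstPotential (0, ζ)

/-- Unfolding `f = V + i b`. [folklore] -/
theorem ernstPotential_apply (p : ℝ × ℝ) :
    S.ernstPotential p = (S.V p : ℂ) + (S.b p : ℂ) * Complex.I := rfl

/-- Unfolding the upper-axis potential `f(0, ζ)`. [folklore] -/
theorem upperAxisPotential_apply (ζ : ℝ) :
    S.upperAxisPotential ζ = (S.V (0, ζ) : ℂ) + (S.b (0, ζ) : ℂ) * Complex.I := rfl

/-- `Re ℰ(ζ) = e^{2U}(0, ζ)`. [folklore] -/
@[simp]
theorem re_upperAxisPotential (ζ : ℝ) : (S.upperAxisPotential ζ).re = S.V (0, ζ) := by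
  simp [upperAxisPotential, ernstPotential]

/-- `Im ℰ(ζ) = b(0, ζ)`. [folklore] -/
@[simp]
theorem im_upperAxisPotential (ζ : ℝ) : (S.upperAxisPotential ζ).im = S.b (0, ζ) := by
  simp [upperAxisPotential, ernstPotential]

/-- Unfolding `a = −W/V`. [folklore] -/
theorem gravitomagnetic_apply (p : ℝ × ℝ) : S.gravitomagnetic p = -(S.W p / S.V p) := rfl

/-- The Ernst potential solves the vacuum Ernst equation on `{ρ > 0}`.
[cite: NeugebauerHennig2012, §2 (eq. (Ernst))] -/
theorem solvesErnstVacuum : SolvesErnstVacuum S.ernstPotential :=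
  S.ernst

/-- The Ernst potential is smooth on the open half-plane. [folklore] -/
theorem contDiffOn_V_weylHalfPlane : ContDiffOn ℝ ∞ S.V weylHalfPlane := by
  refine S.V_smooth.mono fun p hp => ⟨weylHalfPlane_subset_closed hp, ?_⟩
  rintro ⟨h0, -⟩
  exact (ne_of_gt hp) h0

/-- Every horizon rod is non-empty. [folklore] -/
theorem horizonRod_nonempty (i : Fin n) : (horizonRod S.K i).Nonempty :=
  Ernst.horizonRod_nonempty S.K_strictAnti i

/-- **`e^{2U} ≠ 0` on the open horizon rods** (it vanishes only at the endpoints,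
[cite: NeugebauerHennig2012, §4]): forced by (B2) under the total reading of `a = −W/V`.
[cite: NeugebauerHennig2012, §2 (eq. (B2))] -/
theorem V_ne_zero_of_mem_horizonRod {i : Fin n} {ζ : ℝ} (hζ : ζ ∈ horizonRod S.K i) :
    S.V (0, ζ) ≠ 0 := by
  intro hV
  have h := S.horizon i ζ hζ
  rw [gravitomagneticOf, hV, div_zero, neg_zero, mul_zero, add_zero] at h
  exact one_ne_zero h

/-- **The horizons rotate**: `Ω_i ≠ 0` ("rotate with angular velocities `Ω_i ≠ 0`"), forced by
(B2) `1 + Ω_i a = 0`. [cite: Hennig2020, §2] [cite: NeugebauerHennig2012, §2 (eq. (B2))] -/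
theorem Ω_ne_zero (i : Fin n) : S.Ω i ≠ 0 := by
  intro hΩ
  obtain ⟨ζ, hζ⟩ := S.horizonRod_nonempty i
  have h := S.horizon i ζ hζ
  rw [hΩ, zero_mul, add_zero] at h
  exact one_ne_zero h

/-- On a horizon rod `a = −1/Ω_i` is constant. [cite: NeugebauerHennig2012, §2 (eq. (B2))] -/
theorem gravitomagnetic_eq_of_mem_horizonRod {i : Fin n} {ζ : ℝ} (hζ : ζ ∈ horizonRod S.K i) :
    S.gravitomagnetic (0, ζ) = -(S.Ω i)⁻¹ := by
  have h := S.horizon i ζ hζ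
  have hΩ := S.Ω_ne_zero i
  rw [gravitomagnetic]
  field_simp
  linarith

/-- On the symmetry axis `a = 0`. [cite: NeugebauerHennig2012, §2 (eq. (B1))] -/
theorem gravitomagnetic_eq_zero_of_mem_axisSet {ζ : ℝ} (hζ : ζ ∈ axisSet S.K) :
    S.gravitomagnetic (0, ζ) = 0 := by
  rw [gravitomagnetic_apply, S.axis_W ζ hζ, zero_div, neg_zero]

/-- On the upper axis the real part of the axis potential is the boundary value of `e^{2U}` and
`a = 0` there. [cite: NeugebauerHennig2012, §2 (eq. (B1))] -/
theorem gravitomagnetic_eq_zero_of_mem_upperAxis {ζ : ℝ} (hζ : ζ ∈ upperAxis S.K) :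
    S.gravitomagnetic (0, ζ) = 0 :=
  S.gravitomagnetic_eq_zero_of_mem_axisSet (upperAxis_subset_axisSet S.K hζ)

end NBlackHoleAxisBVP

/-! ### Non-vacuity: flat space (`n = 0`) -/

/-- **Minkowski space** as the `n = 0` member of the class: `f ≡ 1` (`V ≡ 1`, `b ≡ 0`), `W ≡ 0`,
no rods. [cite: NeugebauerHennig2012, §2 (eq. (asflat))] -/
def minkowski : NBlackHoleAxisBVP 0 where
  V := fun _ => 1
  W := fun _ => 0
  b := fun _ => 0
  K := fun j => j.elim0
  K_strictAnti := fun j => j.elim0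
  Ω := fun i => i.elim0
  V_smooth := contDiffOn_const
  W_smooth := contDiffOn_const
  b_smooth := contDiffOn_const
  V_continuousOn := continuousOn_const
  W_continuousOn := continuousOn_const
  b_continuousOn := continuousOn_const
  ernst := by
    intro p _
    have h1 : pdρ (ernstPotentialOf (fun _ : ℝ × ℝ => (1 : ℝ)) fun _ => (0 : ℝ)) = fun _ => 0 := by
      funext q; simp [ernstPotentialOf, pdρ]
    have h2 : pdζ (ernstPotentialOf (fun _ : ℝ × ℝ => (1 : ℝ)) fun _ => (0 : ℝ)) = fun _ => 0 := by
      funext q; simp [ernstPotentialOf, pdζ]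
    simp [ernstResidual, h1, h2]
  twist_ρ := by intro p _; simp
  twist_ζ := by intro p _; simp
  axis_W := fun _ _ => rfl
  horizon := fun i => i.elim0
  V_tendsto := tendsto_const_nhds
  W_tendsto := tendsto_const_nhds
  b_tendsto := tendsto_const_nhds

/-- Flat space has the constant upper-axis potential `1` (`= π₀/r₀`, monic of degree `0`).
[cite: Hennig2020, §3] -/
theorem minkowski_upperAxisPotential (ζ : ℝ) : minkowski.upperAxisPotential ζ = 1 := by
  simp [NBlackHoleAxisBVP.upperAxisPotential_apply, minkowski]

/-! ### The Kerr Ernst potential in Weyl coordinates and its upper-axis values (`n = 1` data) -/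

section Kerr

variable (M a : ℝ)

/-- `σ = √(M² − a²)` (`mp = σ`, `mq = a`, `p² + q² = 1`). [cite: StephaniEtAl2003, (20.36)] -/
def kerrSigma : ℝ := Real.sqrt (M ^ 2 - a ^ 2)

/-- `r₊ = √(ρ² + (ζ + σ)²)`, distance to the lower rod endpoint `(0, −σ)`. [folklore] -/
def kerrRPlus (p : ℝ × ℝ) : ℝ := Real.sqrt (p.1 ^ 2 + (p.2 + kerrSigma M a) ^ 2)

/-- `r₋ = √(ρ² + (ζ − σ)²)`, distance to the upper rod endpoint `(0, σ)`. [folklore] -/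
def kerrRMinus (p : ℝ × ℝ) : ℝ := Real.sqrt (p.1 ^ 2 + (p.2 - kerrSigma M a) ^ 2)

/-- The prolate spheroidal coordinate `x = (r₊ + r₋)/(2σ)`, inverting `ρ = σ√(x²−1)√(1−y²)`,
`ζ = σxy`. [cite: StephaniEtAl2003, (20.6)] -/
def kerrX (p : ℝ × ℝ) : ℝ := (kerrRPlus M a p + kerrRMinus M a p) / (2 * kerrSigma M a)

/-- The prolate spheroidal coordinate `y = (r₊ − r₋)/(2σ)`. [cite: StephaniEtAl2003, (20.6)] -/
def kerrY (p : ℝ × ℝ) : ℝ := (kerrRPlus M a p - kerrRMinus M a p) / (2 * kerrSigma M a)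

/-- **The Kerr Ernst potential in Weyl coordinates**: `ℰ = (1 − ξ)/(1 + ξ)` with
`ξ^{−1} = px − iqy`, i.e. `ℰ = (px − 1 − iqy)/(px + 1 − iqy)`, `p = σ/M`, `q = a/M`, written in
`(ρ, ζ)` through `x`, `y` above (mass `M > |a|`, sub-extremal). Transcription only: that it solves
(19.41) is (20.37) of the source and is not re-proved here. [cite: StephaniEtAl2003, (19.46), (20.35)–(20.36)] -/
def kerrErnstPotential (p : ℝ × ℝ) : ℂ :=
  ((kerrSigma M a / M * kerrX M a p : ℝ) - 1 - (a / M * kerrY M a p : ℝ) * Complex.I) /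
    ((kerrSigma M a / M * kerrX M a p : ℝ) + 1 - (a / M * kerrY M a p : ℝ) * Complex.I)

variable {M a}

/-- `σ > 0` in the sub-extremal range `|a| < M`. [folklore] -/
theorem kerrSigma_pos (ha : |a| < M) : 0 < kerrSigma M a := by
  unfold kerrSigma
  apply Real.sqrt_pos.mpr
  have h1 : a ^ 2 < M ^ 2 := by
    have hM : 0 ≤ M := le_trans (abs_nonneg a) ha.le
    calc a ^ 2 = |a| ^ 2 := (sq_abs a).symm
      _ < M ^ 2 := by
        exact pow_lt_pow_left₀ ha (abs_nonneg a) two_ne_zero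
  linarith

/-- On the upper axis `ρ = 0`, `ζ > σ`: `r₊ = ζ + σ`. [folklore] -/
theorem kerrRPlus_upperAxis {ζ : ℝ} (ha : |a| < M) (hζ : kerrSigma M a < ζ) :
    kerrRPlus M a (0, ζ) = ζ + kerrSigma M a := by
  have hσ := kerrSigma_pos ha
  unfold kerrRPlus
  simp only [ne_eq, OfNat.ofNat_ne_zero, not_false_eq_true, zero_pow, zero_add]
  exact Real.sqrt_sq (by linarith)

/-- On the upper axis `ρ = 0`, `ζ > σ`: `r₋ = ζ − σ`. [folklore] -/
theorem kerrRMinus_upperAxis {ζ : ℝ} (hζ : kerrSigma M a < ζ) :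
    kerrRMinus M a (0, ζ) = ζ - kerrSigma M a := by
  unfold kerrRMinus
  simp only [ne_eq, OfNat.ofNat_ne_zero, not_false_eq_true, zero_pow, zero_add]
  exact Real.sqrt_sq (by linarith)

/-- On the upper axis `x = ζ/σ`, `y = 1`. [cite: StephaniEtAl2003, (20.6)] -/
theorem kerrX_upperAxis {ζ : ℝ} (ha : |a| < M) (hζ : kerrSigma M a < ζ) :
    kerrX M a (0, ζ) = ζ / kerrSigma M a := by
  have hσ := kerrSigma_pos ha
  rw [kerrX, kerrRPlus_upperAxis ha hζ, kerrRMinus_upperAxis hζ]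
  field_simp
  ring

/-- On the upper axis `y = 1`. [cite: StephaniEtAl2003, (20.6)] -/
theorem kerrY_upperAxis {ζ : ℝ} (ha : |a| < M) (hζ : kerrSigma M a < ζ) :
    kerrY M a (0, ζ) = 1 := by
  have hσ := kerrSigma_pos ha
  rw [kerrY, kerrRPlus_upperAxis ha hζ, kerrRMinus_upperAxis hζ]
  field_simp
  ring

/-- **Kerr axis data** (`n = 1` sanity content): on the upper axis `ζ > σ` the Kerr Ernst potential
is the ratio of MONIC LINEAR polynomials `ℰ(ζ) = (ζ − M − ia)/(ζ + M − ia)` — the `n = 1` case of the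
rational axis form `π_n/r_n` of [cite: Hennig2020, §3]. [cite: StephaniEtAl2003, (20.35)–(20.36)] -/
theorem kerrErnstPotential_upperAxis {ζ : ℝ} (hM : 0 < M) (ha : |a| < M)
    (hζ : kerrSigma M a < ζ) :
    kerrErnstPotential M a (0, ζ) =
      (((ζ - M : ℝ) : ℂ) - (a : ℂ) * Complex.I) / (((ζ + M : ℝ) : ℂ) - (a : ℂ) * Complex.I) := by
  have hσ := kerrSigma_pos ha
  have hζ0 : 0 < ζ := hσ.trans hζ
  have hden : (((ζ + M : ℝ) : ℂ) - (a : ℂ) * Complex.I) ≠ 0 := by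
    intro h
    have := congrArg Complex.re h
    simp at this
    linarith
  have hden' : (((kerrSigma M a / M * (ζ / kerrSigma M a) : ℝ) : ℂ) + 1 -
      ((a / M * 1 : ℝ) : ℂ) * Complex.I) ≠ 0 := by
    intro h
    have := congrArg Complex.re h
    simp at this
    have h2 : kerrSigma M a / M * (ζ / kerrSigma M a) = ζ / M := by
      field_simp
    rw [h2] at this
    have : 0 < ζ / M + 1 := by positivity
    linarith
  rw [kerrErnstPotential, kerrX_upperAxis ha hζ, kerrY_upperAxis ha hζ, div_eq_div_iff hden' hden]
  have hMc : (M : ℂ) ≠ 0 := by exact_mod_cast hM.ne'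
  have hσc : (kerrSigma M a : ℂ) ≠ 0 := by exact_mod_cast hσ.ne'
  push_cast
  field_simp

end Kerr

end Ernst

end Literature.Geometry.Lorentzian

end
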